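import Summits.SmoothPoincare4.SmoothPoincare4.Theorems.SblfDescentRungOneHelperF3TCalc
import HarnessLib

/-!
# The radial model in `ℝ³` for the transported torus coordinate (layer T of brick F3, part 1b)

Auxiliary file (layer T.1b) of the registered layer `helper_f3_transport` of stub
`helper_sliceGluing_bottConstruction` (apex brick F3), line `Sketch`, crux `SblfDescent.RungOne`.

(Crux item stmt-SmoothPoincare4-18531; skeleton `Cruxes/RungOne/Lines/Sketch.lean`.)

Inside the fold tube `ν : S¹ × ℝ³ → X` of the round circle (`h ∘ ν = Q`,
`Q = y₀² + y₁² - y₂²`) the transporting field of layer T is the radial field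
`(2ρ²)⁻¹ (y₀ ∂₀ + y₁ ∂₁)` of the normal coordinates (`ρ² = y₀² + y₁²`): it raises `Q` at unit
speed and preserves `y₂`, the planar direction and the circle coordinate, so that the rigid
formula `A ∘ ν = R(-arctan y₂) (u₀, σ u₁)` of the torus angular map is constant along it
(Milnor 1963, proof of Thm. 3.1: pushing levels along a field normalised by `X(f) = 1`).  This
file is the elementary geometry of its time-`s` map
`F3T.rad s y = (√(ρ² + s)/ρ · y₀, √(ρ² + s)/ρ · y₁, y₂)`:
`Q (rad s y) = Q y + s`, `ρ² (rad s y) = ρ² y + s`, same `y₂`, same planar direction, the group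
law, continuity in `s`, and the converse `F3T.eq_rad_of_invariants` (a point with the same `y₂`,
the same planar direction and `ρ²` raised by `s` IS `rad s y`), by which the flow lines in the
tube are recognised from their first integrals.

## References

* J. Milnor, *Morse theory*, Ann. of Math. Studies 51 (1963), proof of Thm. 3.1. [Milnor1963]
* K. Hayano, *On genus-1 simplified broken Lefschetz fibrations*, Algebr. Geom. Topol. 11
  (2011), Def. 2.1 (4) (the fold model `Q`). [Hayano2011]
-/

set_option linter.dupNamespace false

noncomputable section

open scoped ContDiff Topology
open Set Filter

namespace Summit.SmoothPoincare4.SmoothPoincare4.Cruxes.RungOne.Sketch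

namespace F3T

/-! ### The radial model in `ℝ³` -/

/-- The quadratic form `Q = y₀² + y₁² - y₂²` of the fold. [folklore] -/
def Q3 (y : EuclideanSpace ℝ (Fin 3)) : ℝ := y 0 ^ 2 + y 1 ^ 2 - y 2 ^ 2

/-- The squared planar radius `ρ² = y₀² + y₁²`. [folklore] -/
def rho2 (y : EuclideanSpace ℝ (Fin 3)) : ℝ := y 0 ^ 2 + y 1 ^ 2

/-- The planar part `(y₀, y₁)` of a vector of `ℝ³`, as a continuous linear map. [folklore] -/
def pl : EuclideanSpace ℝ (Fin 3) →L[ℝ] EuclideanSpace ℝ (Fin 2) :=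
  (EuclideanSpace.equiv (Fin 2) ℝ).symm.toContinuousLinearMap.comp
    (ContinuousLinearMap.pi fun i : Fin 2 => EuclideanSpace.proj (𝕜 := ℝ) (Fin.castSucc i))

/-- `pl y 0 = y 0`. [folklore] -/
@[simp] theorem pl_apply_zero (y : EuclideanSpace ℝ (Fin 3)) : pl y 0 = y 0 := rfl
/-- `pl y 1 = y 1`. [folklore] -/
@[simp] theorem pl_apply_one (y : EuclideanSpace ℝ (Fin 3)) : pl y 1 = y 1 := rfl

/-- `Q` is continuous. [folklore] -/
theorem continuous_Q3 : Continuous Q3 := by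
  unfold Q3; fun_prop

/-- `ρ²` is continuous. [folklore] -/
theorem continuous_rho2 : Continuous rho2 := by
  unfold rho2; fun_prop

/-- The coordinates of `ℝ³` are smooth. [folklore] -/
theorem contDiff_apply_three (i : Fin 3) : ContDiff ℝ ∞ fun p : EuclideanSpace ℝ (Fin 3) => p i :=
  (EuclideanSpace.proj (𝕜 := ℝ) i).contDiff

/-- `Q` is smooth. [folklore] -/
theorem contDiff_Q3 : ContDiff ℝ ∞ Q3 := by
  unfold Q3
  exact (((contDiff_apply_three 0).pow 2).add ((contDiff_apply_three 1).pow 2)).sub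
    ((contDiff_apply_three 2).pow 2)

/-- **The differential of `Q`**: `DQ(y) w = 2 (y₀ w₀ + y₁ w₁ - y₂ w₂)`. [folklore] -/
theorem fderiv_Q3_apply (y w : EuclideanSpace ℝ (Fin 3)) :
    fderiv ℝ Q3 y w = 2 * (y 0 * w 0 + y 1 * w 1 - y 2 * w 2) := by
  have hline : HasDerivAt (fun t : ℝ => Q3 (y + t • w))
      (2 * (y 0 * w 0 + y 1 * w 1 - y 2 * w 2)) 0 := by
    have heq : (fun t : ℝ => Q3 (y + t • w)) = fun t =>
        Q3 y + t * (2 * (y 0 * w 0 + y 1 * w 1 - y 2 * w 2)) + t ^ 2 * Q3 w := by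
      funext t
      simp only [Q3, PiLp.add_apply, PiLp.smul_apply, smul_eq_mul]
      ring
    rw [heq]
    have h1 : HasDerivAt (fun t : ℝ => Q3 y + t * (2 * (y 0 * w 0 + y 1 * w 1 - y 2 * w 2)))
        (1 * (2 * (y 0 * w 0 + y 1 * w 1 - y 2 * w 2))) 0 :=
      ((hasDerivAt_id (0 : ℝ)).mul_const _).const_add _
    have h2 : HasDerivAt (fun t : ℝ => t ^ 2 * Q3 w) ((2 : ℕ) * (0 : ℝ) ^ (2 - 1) * Q3 w) 0 :=
      ((hasDerivAt_pow 2 (0 : ℝ))).mul_const _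
    have h : HasDerivAt (fun t : ℝ => Q3 y + t * (2 * (y 0 * w 0 + y 1 * w 1 - y 2 * w 2)) + t ^ 2 * Q3 w)
        (1 * (2 * (y 0 * w 0 + y 1 * w 1 - y 2 * w 2)) + (2 : ℕ) * (0 : ℝ) ^ (2 - 1) * Q3 w) 0 :=
      HasDerivAt.add h1 h2
    refine h.congr_deriv ?_
    simp
  exact (hasDerivAt_comp_line ((contDiff_Q3.differentiable (by simp)) y).hasFDerivAt w).unique hline

/-- `ρ² = ‖pl y‖²`. [folklore] -/
theorem rho2_eq_norm_sq (y : EuclideanSpace ℝ (Fin 3)) : rho2 y = ‖pl y‖ ^ 2 := by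
  rw [norm_sq_eq_two, pl_apply_zero, pl_apply_one, rho2]

/-- `0 ≤ ρ²`. [folklore] -/
theorem rho2_nonneg (y : EuclideanSpace ℝ (Fin 3)) : 0 ≤ rho2 y := by unfold rho2; positivity

/-- `Q = ρ² - y₂²`. [folklore] -/
theorem Q3_eq (y : EuclideanSpace ℝ (Fin 3)) : Q3 y = rho2 y - y 2 ^ 2 := rfl

/-- `‖y‖² = ρ² + y₂²`. [folklore] -/
theorem norm_sq_eq_three (y : EuclideanSpace ℝ (Fin 3)) : ‖y‖ ^ 2 = rho2 y + y 2 ^ 2 := by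
  rw [EuclideanSpace.norm_sq_eq, Fin.sum_univ_three, Real.norm_eq_abs, Real.norm_eq_abs,
    Real.norm_eq_abs, sq_abs, sq_abs, sq_abs, rho2]

/-- `|Q| ≤ ‖y‖²`. [folklore] -/
theorem abs_Q3_le (y : EuclideanSpace ℝ (Fin 3)) : |Q3 y| ≤ ‖y‖ ^ 2 := by
  rw [norm_sq_eq_three, Q3_eq, abs_le]
  have h1 := rho2_nonneg y
  have h2 := sq_nonneg (y 2)
  constructor <;> linarith

/-- `pl y = 0 ↔ ρ² = 0`. [folklore] -/
theorem pl_ne_zero_of_rho2_pos {y : EuclideanSpace ℝ (Fin 3)} (h : 0 < rho2 y) : pl y ≠ 0 := by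
  intro h0
  rw [rho2_eq_norm_sq, h0, norm_zero] at h
  norm_num at h

/-- **The radial displacement** by time `s` of the radial field `(2ρ²)⁻¹ (y₀ ∂₀ + y₁ ∂₁)`:
`rad s y = (√(ρ² + s)/ρ · y₀, √(ρ² + s)/ρ · y₁, y₂)`. [folklore] -/
def rad (s : ℝ) (y : EuclideanSpace ℝ (Fin 3)) : EuclideanSpace ℝ (Fin 3) :=
  !₂[√(rho2 y + s) / √(rho2 y) * y 0, √(rho2 y + s) / √(rho2 y) * y 1, y 2]

/-- The scaling factor of `rad`. [folklore] -/
def radScale (s : ℝ) (y : EuclideanSpace ℝ (Fin 3)) : ℝ := √(rho2 y + s) / √(rho2 y)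

/-- First coordinate of `rad`. [folklore] -/
@[simp] theorem rad_apply_zero (s : ℝ) (y : EuclideanSpace ℝ (Fin 3)) : rad s y 0 = radScale s y * y 0 := rfl
/-- Second coordinate of `rad`. [folklore] -/
@[simp] theorem rad_apply_one (s : ℝ) (y : EuclideanSpace ℝ (Fin 3)) : rad s y 1 = radScale s y * y 1 := rfl
/-- `rad` keeps `y₂`. [folklore] -/
@[simp] theorem rad_apply_two (s : ℝ) (y : EuclideanSpace ℝ (Fin 3)) : rad s y 2 = y 2 := rfl

/-- The planar part of `rad s y` is a positive multiple of that of `y` (for `ρ² + s > 0`).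
[folklore] -/
theorem pl_rad (s : ℝ) (y : EuclideanSpace ℝ (Fin 3)) : pl (rad s y) = radScale s y • pl y := by
  ext i; fin_cases i <;> simp [pl]

/-- The scaling factor is positive when `ρ² > 0` and `ρ² + s > 0`. [folklore] -/
theorem radScale_pos {s : ℝ} {y : EuclideanSpace ℝ (Fin 3)} (h : 0 < rho2 y) (hs : 0 < rho2 y + s) :
    0 < radScale s y :=
  div_pos (Real.sqrt_pos.2 hs) (Real.sqrt_pos.2 h)

/-- `(radScale s y)² ρ² = ρ² + s`. [folklore] -/
theorem radScale_sq_mul {s : ℝ} {y : EuclideanSpace ℝ (Fin 3)} (h : 0 < rho2 y) (hs : 0 ≤ rho2 y + s) :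
    radScale s y ^ 2 * rho2 y = rho2 y + s := by
  rw [radScale, div_pow, Real.sq_sqrt hs, Real.sq_sqrt h.le, div_mul_cancel₀ _ h.ne']

/-- **`ρ²` grows linearly**: `ρ² (rad s y) = ρ² y + s`. [folklore] -/
theorem rho2_rad {s : ℝ} {y : EuclideanSpace ℝ (Fin 3)} (h : 0 < rho2 y) (hs : 0 ≤ rho2 y + s) :
    rho2 (rad s y) = rho2 y + s := by
  rw [← radScale_sq_mul h hs, rho2, rad_apply_zero, rad_apply_one, rho2]; ring

/-- **The height grows linearly**: `Q (rad s y) = Q y + s`. [folklore] -/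
theorem Q3_rad {s : ℝ} {y : EuclideanSpace ℝ (Fin 3)} (h : 0 < rho2 y) (hs : 0 ≤ rho2 y + s) :
    Q3 (rad s y) = Q3 y + s := by
  rw [Q3_eq, Q3_eq, rho2_rad h hs, rad_apply_two]; ring

/-- `‖rad s y‖² = ‖y‖² + s`. [folklore] -/
theorem norm_sq_rad {s : ℝ} {y : EuclideanSpace ℝ (Fin 3)} (h : 0 < rho2 y) (hs : 0 ≤ rho2 y + s) :
    ‖rad s y‖ ^ 2 = ‖y‖ ^ 2 + s := by
  rw [norm_sq_eq_three, norm_sq_eq_three, rho2_rad h hs, rad_apply_two]; ring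

/-- `rad 0 = id`. [folklore] -/
theorem rad_zero {y : EuclideanSpace ℝ (Fin 3)} (h : 0 < rho2 y) : rad 0 y = y := by
  have h1 : radScale 0 y = 1 := by rw [radScale, add_zero, div_self (Real.sqrt_pos.2 h).ne']
  ext i; fin_cases i
  · show rad 0 y 0 = y 0; rw [rad_apply_zero, h1, one_mul]
  · show rad 0 y 1 = y 1; rw [rad_apply_one, h1, one_mul]
  · rfl

/-- The direction of the planar part is preserved by `rad`. [folklore] -/
theorem unitVec_pl_rad {s : ℝ} {y : EuclideanSpace ℝ (Fin 3)} (h : 0 < rho2 y) (hs : 0 < rho2 y + s) :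
    unitVec (pl (rad s y)) = unitVec (pl y) := by
  rw [pl_rad, unitVec_smul (radScale_pos h hs)]

/-- **The group law** `rad t (rad s y) = rad (s + t) y`. [folklore] -/
theorem rad_rad {s t : ℝ} {y : EuclideanSpace ℝ (Fin 3)} (h : 0 < rho2 y) (hs : 0 < rho2 y + s) :
    rad t (rad s y) = rad (s + t) y := by
  have hsc : radScale t (rad s y) * radScale s y = radScale (s + t) y := by
    rw [radScale, radScale, radScale, rho2_rad h hs.le, ← add_assoc, div_mul_div_comm,
      mul_comm (√(rho2 y + s)) _, mul_div_mul_right _ _ (Real.sqrt_pos.2 hs).ne']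
  ext i; fin_cases i
  · show rad t (rad s y) 0 = rad (s + t) y 0
    rw [rad_apply_zero, rad_apply_zero, rad_apply_zero, ← mul_assoc, hsc]
  · show rad t (rad s y) 1 = rad (s + t) y 1
    rw [rad_apply_one, rad_apply_one, rad_apply_one, ← mul_assoc, hsc]
  · rfl

/-- **A point with prescribed `Q`, `y₂` and planar direction is a radial displacement**: if
`y' 2 = y 2`, `unitVec (pl y') = unitVec (pl y)` and `ρ²(y') = ρ²(y) + s` (`ρ²(y), ρ²(y') > 0`),
then `y' = rad s y`. [folklore] -/
theorem eq_rad_of_invariants {s : ℝ} {y y' : EuclideanSpace ℝ (Fin 3)}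
    (h' : 0 < rho2 y') (h2 : y' 2 = y 2) (hdir : unitVec (pl y') = unitVec (pl y))
    (hρ : rho2 y' = rho2 y + s) : y' = rad s y := by
  have hn : ‖pl y‖ = √(rho2 y) := by rw [rho2_eq_norm_sq, Real.sqrt_sq (norm_nonneg _)]
  have hn' : ‖pl y'‖ = √(rho2 y + s) := by rw [← hρ, rho2_eq_norm_sq, Real.sqrt_sq (norm_nonneg _)]
  have hpl : pl y' = radScale s y • pl y := by
    have hne : ‖pl y'‖ ≠ 0 := norm_ne_zero_iff.2 (pl_ne_zero_of_rho2_pos h')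
    have e1 : pl y' = ‖pl y'‖ • unitVec (pl y') := by
      rw [unitVec, smul_smul, mul_inv_cancel₀ hne, one_smul]
    rw [e1, hdir, unitVec, smul_smul, hn', hn, radScale, div_eq_mul_inv]
  ext i; fin_cases i
  · show y' 0 = rad s y 0
    have := congrArg (fun p : EuclideanSpace ℝ (Fin 2) => p 0) hpl
    simpa using this
  · show y' 1 = rad s y 1
    have := congrArg (fun p : EuclideanSpace ℝ (Fin 2) => p 1) hpl
    simpa using this
  · exact h2

/-- `rad s y` as a combination of two fixed vectors. [folklore] -/
theorem rad_eq_smul_add (s : ℝ) (y : EuclideanSpace ℝ (Fin 3)) :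
    rad s y = radScale s y • !₂[y 0, y 1, 0] + !₂[0, 0, y 2] := by
  ext i; fin_cases i <;> simp

/-- `s ↦ rad s y` is continuous. [folklore] -/
theorem continuous_rad (y : EuclideanSpace ℝ (Fin 3)) : Continuous fun s : ℝ => rad s y := by
  have hsc : Continuous fun s : ℝ => radScale s y :=
    ((continuous_const.add continuous_id).sqrt).div_const _
  have heq : (fun s : ℝ => rad s y) = fun s => radScale s y • !₂[y 0, y 1, 0] + !₂[0, 0, y 2] := by
    funext s; exact rad_eq_smul_add s y
  rw [heq]
  exact (hsc.smul continuous_const).add continuous_const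

end F3T

end Summit.SmoothPoincare4.SmoothPoincare4.Cruxes.RungOne.Sketch

end
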